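import Literature.AlgebraicGeometry.Modules.PushforwardBaseChangeHom
import Mathlib.AlgebraicGeometry.Pullbacks
import HarnessLib

/-!
# Containment after base change, read on the push-forward: `pr^* φ = 0 ⟺ b^*(p_* φ) = 0`

[MumfordFogartyKirwan1994] Ch. 6 §3 Prop. 6.16 / [EGAIII2] 7.7 (cohomology and base change) pattern: for a projective flat
`p : X ⟶ S`, a closed condition on `X` cut out by a map of sheaves `φ` becomes, after twisting so that `p_*` commutes with base
change and the source is relatively generated, the vanishing of the base change `b^*(p_*φ)` of a map between vector bundles
on `S` — a CLOSED condition on the base (★ `Morphisms/ContainmentLocusClosed`, hypothesis `hrep`).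

THIS FILE proves the MATE ALGEBRA of that pattern (steps 3–5 of the cell's (h6-d) design `H6d-SOCKETS`), for ANY commutative
square `pr ≫ p = pT ≫ b` and any morphism `φ : F ⟶ G` of `𝒪_X`-modules, with the two sheaf-theoretic inputs as NAMED HYPOTHESES
(instance binders):

* (hgen) `Epi ((pullbackPushforwardAdjunction p).counit.app F)` — «`p^* p_* F ⟶ F` is onto» (`F = 𝓘(n)` relatively generated);
* (hbc)  `Mono (pushforwardBaseChangeHom w G)` — «`b^* p_* G ⟶ pT_* pr^* G` is injective» (an ISOMORPHISM when `p_*G`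
  commutes with base change, `G = 𝒪_X(n)`; ★ `Modules/PushforwardBaseChangeHom`).

Results: `pullback_map_pushforward_map_eq_zero_of_pullback_map_eq_zero` (⇒, uses (hbc) only),
`pullback_map_eq_zero_of_pullback_map_pushforward_map_eq_zero` (⇐, uses (hgen) only; `epi_pushforwardBaseChangeCounit`),
**`pullback_map_eq_zero_iff`**, and the reading on Mathlib's CHOSEN fibre product `X ×_S T`
(**`pullback_fst_map_eq_zero_iff`**: `(pullback.fst p b)^* φ = 0 ⟺ b^*(p_*φ) = 0` for every `b : T ⟶ S`) — the right-hand
side is VERBATIM the right-hand side `(Scheme.Modules.pullback b).map u = 0` of ★ `ContainmentLocusClosed`'s `hrep` with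
`u := (Scheme.Modules.pushforward p).map φ`; the left-hand bridge «`𝓘 ≤ (pullback.fst p b).ker ⟺ (pullback.fst p b)^*(ι ⊗ 𝒪(n)) = 0`»
is the sequel file.

Theorems only; no `sorry`, no instance, no named fact.  Cell hodgecm-mathlib, F-DAG second wave (h6-d) FILE B.  HC_CM is proved
only modulo the printed citations until rung 0 closes; this file discharges none of them.

## References
* [MumfordFogartyKirwan1994] D. Mumford, J. Fogarty, F. Kirwan, *Geometric Invariant Theory*, 3rd ed. (1994), Ch. 6 §3
  Prop. 6.16 (p. 126).
* [Hartshorne1977] R. Hartshorne, *Algebraic Geometry* (1977), II §5 p. 110 (adjunction `f^* ⊣ f_*`), III Prop. 9.3 /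
  Remark 9.3.1 (base change morphism), III Thm. 12.11 (cohomology and base change).
* [StacksProject] The Stacks Project, Tag 02N6 (base change map).
-/

noncomputable section

-- `TopCat.Presheaf`/`Scheme.Modules` are not reducible (as in Mathlib's `AlgebraicGeometry/Modules/Sheaf.lean`).
set_option backward.isDefEq.respectTransparency false

open CategoryTheory CategoryTheory.Limits AlgebraicGeometry

universe u

namespace Literature.AlgebraicGeometry.Morphisms

open Literature.AlgebraicGeometry.Modules

/-! ### §1 The mate algebra over an arbitrary commutative square -/

section Square

variable {X S T XT : Scheme.{u}} {pr : XT ⟶ X} {pT : XT ⟶ T} {p : X ⟶ S} {b : T ⟶ S} (w : pr ≫ p = pT ≫ b)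

/-- **(hgen) makes the base-change counit an epimorphism**: if `ε_F : p^* p_* F ⟶ F` is onto, so is
`pT^* b^* p_* F = pr^* p^* p_* F ⟶ pr^* F` (pull-back is a left adjoint, hence preserves epimorphisms).
[cite: Hartshorne1977, II §5 p. 110] -/
theorem epi_pushforwardBaseChangeCounit (F : X.Modules)
    [Epi ((Scheme.Modules.pullbackPushforwardAdjunction p).counit.app F)] :
    Epi (pushforwardBaseChangeCounit w F) := by
  unfold pushforwardBaseChangeCounit
  infer_instance

/-- **⇒ (uses (hbc) only)**: if `pr^* φ = 0` then `b^*(p_* φ) = 0` — by naturality of the base-change morphism,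
`b^*(p_*φ) ≫ β_G = β_F ≫ pT_*(pr^*φ) = 0`, and `β_G` is a monomorphism. [cite: MumfordFogartyKirwan1994, Ch. 6 §3 Prop. 6.16 (p. 126)]
[cite: Hartshorne1977, III Prop. 9.3 (Remark 9.3.1)] -/
theorem pullback_map_pushforward_map_eq_zero_of_pullback_map_eq_zero {F G : X.Modules} (φ : F ⟶ G)
    [Mono (pushforwardBaseChangeHom w G)] (h : (Scheme.Modules.pullback pr).map φ = 0) :
    (Scheme.Modules.pullback b).map ((Scheme.Modules.pushforward p).map φ) = 0 := by
  rw [← cancel_mono (pushforwardBaseChangeHom w G), zero_comp, pushforwardBaseChangeHom_naturality, h,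
    Functor.map_zero, comp_zero]

include w in
/-- **⇐ (uses (hgen) only)**: if `b^*(p_* φ) = 0` then `pr^* φ = 0` — by naturality of the base-change counit,
`c_F ≫ pr^*φ = pT^*(b^*(p_*φ)) ≫ c_G = 0`, and `c_F` is an epimorphism. [cite: MumfordFogartyKirwan1994, Ch. 6 §3 Prop. 6.16 (p. 126)]
[cite: Hartshorne1977, III Prop. 9.3 (Remark 9.3.1)] -/
theorem pullback_map_eq_zero_of_pullback_map_pushforward_map_eq_zero {F G : X.Modules} (φ : F ⟶ G)
    [Epi ((Scheme.Modules.pullbackPushforwardAdjunction p).counit.app F)]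
    (h : (Scheme.Modules.pullback b).map ((Scheme.Modules.pushforward p).map φ) = 0) :
    (Scheme.Modules.pullback pr).map φ = 0 := by
  haveI := epi_pushforwardBaseChangeCounit w F
  rw [← cancel_epi (pushforwardBaseChangeCounit w F), comp_zero, ← pushforwardBaseChangeCounit_naturality, h,
    Functor.map_zero, zero_comp]

/-- **`pr^* φ = 0 ⟺ b^*(p_* φ) = 0`** under (hgen) for the source and (hbc) for the target
([MumfordFogartyKirwan1994] Prop. 6.16 pattern: a vanishing condition upstairs is the vanishing of a map of sheaves on the
base after base change). [cite: MumfordFogartyKirwan1994, Ch. 6 §3 Prop. 6.16 (p. 126)] [cite: Hartshorne1977, III Theorem 12.11] -/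
theorem pullback_map_eq_zero_iff {F G : X.Modules} (φ : F ⟶ G)
    [Epi ((Scheme.Modules.pullbackPushforwardAdjunction p).counit.app F)] [Mono (pushforwardBaseChangeHom w G)] :
    (Scheme.Modules.pullback pr).map φ = 0 ↔
      (Scheme.Modules.pullback b).map ((Scheme.Modules.pushforward p).map φ) = 0 :=
  ⟨pullback_map_pushforward_map_eq_zero_of_pullback_map_eq_zero w φ,
    pullback_map_eq_zero_of_pullback_map_pushforward_map_eq_zero w φ⟩

end Square

/-! ### §2 On the chosen fibre product: the right-hand side of `hrep` -/

section Chosen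

variable {X S : Scheme.{u}} (p : X ⟶ S) {F G : X.Modules} (φ : F ⟶ G)

/-- **The `hrep` shape**: for every base change `b : T ⟶ S`, with `X_T := X ×_S T` Mathlib's chosen pull-back and
`pr := pullback.fst p b`, **`pr^* φ = 0 ⟺ (Scheme.Modules.pullback b).map ((Scheme.Modules.pushforward p).map φ) = 0`** —
provided `ε_F` is onto (hgen) and the base-change morphism of `G` along EVERY `b` is a monomorphism (hbc).  With
`φ := ι ⊗ 𝒪_X(n) : 𝓘(n) ⟶ 𝒪_X(n)` and `u := p_* φ` this is ★ `ContainmentLocusClosed`'s hypothesis `hrep` up to the bridge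
`𝓘 ≤ pr.ker ⟺ pr^*(ι ⊗ 𝒪_X(n)) = 0`. [cite: MumfordFogartyKirwan1994, Ch. 6 §3 Prop. 6.16 (p. 126)]
[cite: Hartshorne1977, III Theorem 12.11] -/
theorem pullback_fst_map_eq_zero_iff [Epi ((Scheme.Modules.pullbackPushforwardAdjunction p).counit.app F)]
    (hbc : ∀ ⦃T : Scheme.{u}⦄ (b : T ⟶ S),
      Mono (pushforwardBaseChangeHom (pullback.condition (f := p) (g := b)) G))
    ⦃T : Scheme.{u}⦄ (b : T ⟶ S) :
    (Scheme.Modules.pullback (pullback.fst p b)).map φ = 0 ↔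
      (Scheme.Modules.pullback b).map ((Scheme.Modules.pushforward p).map φ) = 0 :=
  haveI := hbc b
  pullback_map_eq_zero_iff (pullback.condition (f := p) (g := b)) φ

/-- The same over an ARBITRARY cartesian (indeed any commutative) square presenting `X_T` — the fibre product need not be
Mathlib's chosen one. [cite: MumfordFogartyKirwan1994, Ch. 6 §3 Prop. 6.16 (p. 126)] -/
theorem pullback_map_eq_zero_iff_of_sq [Epi ((Scheme.Modules.pullbackPushforwardAdjunction p).counit.app F)]
    {T XT : Scheme.{u}} {pr : XT ⟶ X} {pT : XT ⟶ T} {b : T ⟶ S} (w : pr ≫ p = pT ≫ b)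
    (hbc : Mono (pushforwardBaseChangeHom w G)) :
    (Scheme.Modules.pullback pr).map φ = 0 ↔
      (Scheme.Modules.pullback b).map ((Scheme.Modules.pushforward p).map φ) = 0 :=
  pullback_map_eq_zero_iff w φ

end Chosen

end Literature.AlgebraicGeometry.Morphisms

end
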